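import Summits.Parity.GeneralizedHardyLittlewood.Theorems.DicksonFibrationDimOnePerimeter
import Summits.Parity.GeneralizedHardyLittlewood.Theorems.LeeYangFibresAbsoluteUpgradeSummit
import HarnessLib

/-!
# Route `DicksonFibration`, crux `DimOne` (stmt-Parity-0819), line `birth` (sieve model), part 4:
# the OPEN CORE `TwoFlatFactorsCore` is exactly the crux (and the sub-problem)

Lead `prover-line-stmt-Parity-0819-c3-0`, 2026-08-17. Part 3 (`…DimOnePerimeter.lean`) proved the instances of the
open stub `TwoFlatFactors` that are theorems (`t ≤ 1`; locally obstructed systems) and the composition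
`twoFlatFactors_of_core'` from the restriction of S2 to `t ≥ 2` forms and systems with `β_p(Ψ) > 0` at every prime.
With the named statement `TwoFlatFactorsCore` of that restriction now in the vocabulary file, this file records the
resulting EXACT position of the registered stub `stub_twoFlatFactorsCore` of the skeleton v4
(`Cruxes/DimOne/Lines/birth.lean`):

* `core_iff_twoFlatFactors : TwoFlatFactorsCore ↔ TwoFlatFactors`, `core_iff_dimOne : TwoFlatFactorsCore ↔ DimOne`,
  `generalizedHardyLittlewood_iff_core : GeneralizedHardyLittlewood ↔ TwoFlatFactorsCore` — the admissible
  Dickson–Hardy–Littlewood prime `t`-tuple conjecture in rough-vs-rough form (`t ≥ 2`, `𝔖(Ψ) > 0`) IS the crux and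
  IS Green–Tao's Conj. 1.2 (all `d`), by the landed perimeter, the landed reduction `twoFlatFactors_iff_dimOne`, and
  the route's proved fibration lemma `Assembly_holds`;
* `core_false_of_unboundedSiegelZeros` — the core is still Landau–Siegel-complete (mod Matomäki–Merikoski): the
  witness family `(n, n + 2q)` has `t = 2` and no local obstruction;
* `sum_twoFlat_fin_two`, `corrTerm_univ_eq` — at `t = 2` the core's sum is the single pure rough–rough correlation
  `Σ_{n ∈ K} Λ♭_N(ψ₀ n) Λ♭_N(ψ₁ n)` (for `(n, n + 2)`: `Σ_{n ≤ N} Λ♭_N(n) Λ♭_N(n + 2)`), the typed target for disprovers.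

References: B. Green, T. Tao, Ann. of Math. 171 (2010), Conj. 1.2, Lemma 1.3, §12 (12.3) [GreenTao2010];
K. Matomäki, J. Merikoski, IMRN (2023), Thm. 1.3 [MatomakiMerikoski2023]; L. E. Dickson, Messenger of Math. 33 (1904)
[Dickson1904].
-/

noncomputable section

namespace Summit.Parity.GeneralizedHardyLittlewood.Cruxes.DimOne.BirthSieve

open scoped BigOperators Classical
open Finset Filter Literature.NumberTheory.Sieve
open Summit.Parity.GeneralizedHardyLittlewood.Theses.DicksonFibration (DimOne Assembly_holds)

variable {t : ℕ}

/-! ## The core is the whole of S2, of the crux, and of the sub-problem -/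

/-- **`TwoFlatFactors` from its core** (named form of `twoFlatFactors_of_core'`). [cite: GreenTao2010, Conj. 1.2] -/
theorem twoFlatFactors_of_core : TwoFlatFactorsCore → TwoFlatFactors :=
  fun h => twoFlatFactors_of_core' h

/-- The core is a restriction of `TwoFlatFactors`. [folklore] -/
theorem core_of_twoFlatFactors : TwoFlatFactors → TwoFlatFactorsCore := by
  intro h t L ht ε hε
  obtain ⟨N₀, hN₀⟩ := h t L (by omega) ε hε
  exact ⟨N₀, fun N hN Ψ hΨ hL _ K hK hKN => hN₀ N hN Ψ hΨ hL K hK hKN⟩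

/-- **S2 is equivalent to its open core.** [folklore] -/
theorem core_iff_twoFlatFactors : TwoFlatFactorsCore ↔ TwoFlatFactors :=
  ⟨twoFlatFactors_of_core, core_of_twoFlatFactors⟩

/-- **The crux from the core.** [cite: GreenTao2010, Conj. 1.2] -/
theorem dimOne_of_core : TwoFlatFactorsCore → DimOne :=
  fun h => dimOne_of_twoFlatFactors (twoFlatFactors_of_core h)

/-- **The core from the crux.** [folklore] -/
theorem core_of_dimOne : DimOne → TwoFlatFactorsCore :=
  fun h => core_of_twoFlatFactors (twoFlatFactors_of_dimOne h)

/-- **THE EXACT POSITION OF THE REGISTERED STUB.** The crux `DimOne` (Dickson–Hardy–Littlewood at `d = 1`, all `t`,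
uniform in the shifts) is EQUIVALENT to `TwoFlatFactorsCore`: the correlations with at least two rough factors
`Λ♭_N = Λ − Λ_{ℤ/P_N}` along a non-degenerate one-dimensional system of `t ≥ 2` forms WITHOUT LOCAL OBSTRUCTION are
`o(N)`, uniformly. (Registered sub-goal `core_iff_dimOne` of stmt-Parity-0819.) [cite: GreenTao2010, Conj. 1.2] -/
theorem core_iff_dimOne : TwoFlatFactorsCore ↔ Summit.Parity.GeneralizedHardyLittlewood.Theses.DicksonFibration.DimOne :=
  ⟨dimOne_of_core, core_of_dimOne⟩

/-- **The sub-problem is equivalent to the core**: Green–Tao's Conj. 1.2 (all `d`, all complexities) holds iff the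
admissible one-dimensional rough–rough correlations are `o(N)` (via the route's proved fibration lemma
`Assembly_holds : DimOne → GeneralizedHardyLittlewood` and the `d := 1` specialisation, tree
`AbsoluteUpgrade.dimOne_of_summit`). [cite: GreenTao2010, Conj. 1.2] -/
theorem generalizedHardyLittlewood_iff_core : _root_.GeneralizedHardyLittlewood ↔ TwoFlatFactorsCore :=
  ⟨fun h => core_of_dimOne
      (Summit.Parity.GeneralizedHardyLittlewood.Theorems.AbsoluteUpgrade.dimOne_of_summit h),
    fun h => Assembly_holds (dimOne_of_core h)⟩

/-- **The core is Landau–Siegel-complete**: modulo the vendored theorem of Matomäki–Merikoski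
(`MatomakiMerikoski2023_pairCorrelation`, Thm. 1.3), Siegel zeros of unbounded quality refute `TwoFlatFactorsCore`
(the witness family `(n, n + 2q)`, `N = q^{10}`, `L = 3` has `t = 2` and no local obstruction; transported through
`twoFlatFactors_of_core`). [cite: MatomakiMerikoski2023, Theorem 1.3] -/
theorem core_false_of_unboundedSiegelZeros
    (hMM : Literature.Barriers.Parity.MatomakiMerikoski2023_pairCorrelation)
    (hU : Literature.Barriers.Parity.UnboundedSiegelZeros) : ¬ TwoFlatFactorsCore :=
  fun h => twoFlatFactors_false_of_unboundedSiegelZeros hMM hU (twoFlatFactors_of_core h)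

/-! ## The core at `t = 2`: one pure rough–rough correlation -/

/-- At `t = 2` the only `T ⊆ [2]` with `#T ≥ 2` is `T = [2]`. [folklore] -/
theorem filter_two_le_card_fin_two :
    (univ : Finset (Fin 2)).powerset.filter (fun T => 2 ≤ T.card) = {univ} := by
  ext T
  simp only [Finset.mem_filter, Finset.mem_powerset, Finset.subset_univ, true_and, Finset.mem_singleton]
  constructor
  · intro hT
    apply Finset.eq_univ_of_card
    have h := Finset.card_le_univ T
    rw [Fintype.card_fin] at h ⊢
    omega
  · rintro rfl
    rw [Finset.card_univ, Fintype.card_fin]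

/-- **At `t = 2` the S2 sum is the single term `C_{[2]}`.** [folklore] -/
theorem sum_twoFlat_fin_two (Ψ : Fin 2 → AffLinForm 1) (K : Set (Fin 1 → ℝ)) (N : ℕ) :
    ∑ T ∈ (univ : Finset (Fin 2)).powerset.filter (fun T => 2 ≤ T.card), corrTerm T Ψ K N =
      corrTerm univ Ψ K N := by
  rw [filter_two_le_card_fin_two, Finset.sum_singleton]

/-- **`C_{[t]}` is the pure rough correlation** `Σ_{n ∈ K ∩ [−N, N]} ∏_i Λ♭_N(ψ_i(n))` (no sieve-model factor).
[cite: GreenTao2010, §12 (12.3)] -/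
theorem corrTerm_univ_eq (Ψ : Fin t → AffLinForm 1) (K : Set (Fin 1 → ℝ)) (N : ℕ) :
    corrTerm univ Ψ K N =
      ∑ n ∈ (latticeBox 1 N).filter (fun n => realPoint n ∈ K), ∏ i, flatZ N ((Ψ i).eval n) := by
  unfold corrTerm
  refine Finset.sum_congr rfl fun n _ => ?_
  rw [Finset.sdiff_self, Finset.prod_empty, mul_one]

/-- **The core at `t = 2`, spelled out**: for pairs it asserts `|Σ_{n ∈ K ∩ [−N,N]} Λ♭_N(ψ₀ n) Λ♭_N(ψ₁ n)| ≤ ε N`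
uniformly over non-degenerate admissible pairs with `‖Ψ‖_N ≤ L` and convex `K ⊆ [−N, N]` (for `(n, n + 2)` and
`K = [1, N]`: `Σ_{n ≤ N} Λ♭_N(n) Λ♭_N(n + 2) = o(N)`, the twin-prime asymptotic in rough-vs-rough form).
[cite: GreenTao2010, Conj. 1.2 and Example 1] -/
theorem core_two (h : TwoFlatFactorsCore) :
    ∀ L : ℕ, ∀ ε : ℝ, 0 < ε → ∃ N₀ : ℕ, ∀ N : ℕ, N₀ ≤ N →
      ∀ Ψ : Fin 2 → AffLinForm 1, IsNondegenerateSystem Ψ → affLinSize Ψ N ≤ L →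
        (∀ p : ℕ, p.Prime → 0 < localFactor Ψ p) →
          ∀ K : Set (Fin 1 → ℝ), Convex ℝ K → K ⊆ realBox 1 N →
            |∑ n ∈ (latticeBox 1 N).filter (fun n => realPoint n ∈ K),
                flatZ N ((Ψ 0).eval n) * flatZ N ((Ψ 1).eval n)| ≤ ε * (N : ℝ) := by
  intro L ε hε
  obtain ⟨N₀, hN₀⟩ := h 2 L le_rfl ε hε
  refine ⟨N₀, fun N hN Ψ hΨ hL hpos K hK hKN => ?_⟩
  have := hN₀ N hN Ψ hΨ hL hpos K hK hKN
  rw [sum_twoFlat_fin_two, corrTerm_univ_eq] at this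
  simpa [Fin.prod_univ_two] using this

end Summit.Parity.GeneralizedHardyLittlewood.Cruxes.DimOne.BirthSieve

end
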